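import Summits.ResolutionOfSingularities.KangarooAtlas.MizutaniOdaEqualityCorollaries
import Summits.ResolutionOfSingularities.KangarooAtlas.MizutaniVectorGroupHolds
import Summits.ResolutionOfSingularities.KangarooAtlas.MizutaniNumber
import Summits.ResolutionOfSingularities.KangarooAtlas.MizutaniAttainedGeneral
import HarnessLib

/-!
# Mizutani's conjecture `m(e) = 2p^e − 1` — entirely in Hironaka's/Mizutani's own vocabulary, UNCONDITIONALLY

Cell topic `Summits/ResolutionOfSingularities/KangarooAtlas` (pub-rosobs); namespace
`Summit.ResolutionOfSingularities.KangarooAtlas.Mizutani`.  AI-written; *AI review is weaker than expert review*; NOT a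
resolution theorem, NOT summit progress (cell self-grade «summit relevance C»).

The Lean chain `mizutaniConjecture` / `mizutaniNumber_eq : m(e) = 2p^e − 1` (`MizutaniConjectureHolds.lean`,
`MizutaniNumber.lean`) is stated with T. Oda's printed description of Hironaka's additive group scheme `B(𝔭)` taken as
DEFINITION (`Literature/…/HironakaGroupScheme.lean`: `invForms`, `ExponentLE`, `hsDimAt`).  Two vocabulary bridges to
Hironaka's/Mizutani's own definitions (`Literature/…/HironakaGroupSchemeMultiplicity.lean`: `U(𝔭) = multAlgebra`,
`B_{P,𝔭} = Spec S/U_+(𝔭)S` with ideal `bIdeal`, `IsVectorGroup`; Mizutani 1973 Def. 1.1, §1 (c)) were displayed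
hypotheses in `MizutaniHironakaDimension.lean` / `MizutaniVectorGroup*.lean` (encloser-2 g4):
(G1) Oda's equality `U(𝔭) ∩ L_e = (L_B)_e` (Oda 1973 Prop. 2.2 (ii)) — now the THEOREM `hirForms_eq_invForms`
(`MizutaniOdaEquality.lean`, this seat); (G2) Hironaka's generation theorem «`U(𝔭)` is generated by additive forms»
(Hironaka 1970 Th. 1 Cor.) — now the THEOREM `HironakaScheme.Hironaka1970_thm1_cor_holds`
(`Literature/…/HironakaGroupSchemeAdditiveGenerators.lean`, cell res-hironaka).  This file combines them: every statement
below is about `B_{P,𝔭} = Spec S/U_+(𝔭)S` and the exponent of `U(𝔭) ∩ L`, with NO named fact and NO displayed hypothesis.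

* `ringKrullDim_quotient_bIdeal_eq_hsDim_holds` — `dim B_{P,𝔭} = hsDim k p 𝔭` (Mizutani Thm. 1.3 = Oda's rank formula);
* `isVectorGroup_iff_exponent_eq_zero_holds` — Mizutani Rem. 1.2: vector group iff exponent `0`;
* **`mizutani_lowerBound_hironaka`** — for every field `k` of characteristic `p`, every `n`, every point `𝔭` of `ℙ^n_k`:
  `2·p^{exponent} ≤ dim B_{P,𝔭} + 1`, i.e. **`m(e) ≥ 2p^e − 1`** (`mizutani_lowerBound_hironaka'`: `dim ≥ 2p^e − 1` as
  soon as the exponent is `≥ e`);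
* **`mizutani_attained_hironaka`** — for every field `k` with a `p`-independent pair (`[k : k^p] ≥ p^2`) and every
  `e ≥ 1`, Mizutani's point `H_e` (`GenAtt.attP`) of `ℙ^{2p^e−2}_k` has exponent `e` and `dim B_{P,𝔭} + 1 = 2p^e`:
  **`m(e) ≤ 2p^e − 1`**; together: `m(e) = 2p^e − 1` in Mizutani's own reading (Remark 2.10: "it is quite likely").

What remains DEFINITIONAL (for a human reviewer, see the cell's MIZUTANI-LEAN.md §2 (G3)): «`mult_𝔭 f ≥ m`» is read as
`f ∈ 𝔭^{(m)}` (`symbPow`: `ℙ^n` is smooth), `dim B_{P,𝔭}` as `ringKrullDim (S ⧸ U_+(𝔭)S)`, and the exponent of `B(𝔭)`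
as that of the graded `k[F]`-module `U(𝔭) ∩ L` (Mizutani §1 (c); `exponent_eq_iff_hirForms`).

References: [Mizutani1973HironakaGroupSchemes] §1 (Def. 1.1, (c), Rem. 1.2, Thm. 1.3), Thm. 2.8, Remark 2.10;
[Oda1983HironakaGroupSchemeII] §2 (p. 1168); [Hironaka1970AdditiveGroups] Th. 1 Cor.
-/

open MvPolynomial Literature.AlgebraicGeometry.Resolution Literature.AlgebraicGeometry.Resolution.HironakaScheme

namespace Summit.ResolutionOfSingularities.KangarooAtlas.Mizutani

universe u

section HironakaSide

variable (k : Type u) [Field k] (p : ℕ) [hp : Fact p.Prime] [CharP k p] {n : ℕ}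
  (𝔭 : Ideal (MvPolynomial (Fin (n + 1)) k))

/-- **`dim B_{P,𝔭} = hsDim k p 𝔭`** for every point of `ℙ^n_k` (Mizutani Thm. 1.3: `dim Spec(S/N S) = dim_k (L_e/N_e)`;
Oda p. 1168: "the dimension of `B(𝔭)` equals the rank of `L/L_B`"), unconditionally.
[cite: Mizutani1973HironakaGroupSchemes, Thm. 1.3; Oda1983HironakaGroupSchemeII, §2 (p. 1168)] -/
theorem ringKrullDim_quotient_bIdeal_eq_hsDim_holds [𝔭.IsPrime] (hP : IsPoint k 𝔭) :
    ringKrullDim (MvPolynomial (Fin (n + 1)) k ⧸ bIdeal k 𝔭) = (hsDim k p 𝔭 : WithBot ℕ∞) :=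
  ringKrullDim_quotient_bIdeal_eq_hsDim_of_oda k p 𝔭 (hirForms_eq_invForms 𝔭) hP

/-- **Mizutani's Remark 1.2, unconditionally**: `B_{P,𝔭}` is a vector group (its ideal `U_+(𝔭)S` is generated by linear
forms) iff its exponent is `0`. [cite: Mizutani1973HironakaGroupSchemes, Rem. 1.2 (p. 86)] -/
theorem isVectorGroup_iff_exponent_eq_zero_holds [𝔭.IsPrime] (hP : IsPoint k 𝔭) :
    IsVectorGroup k 𝔭 ↔ exponent k p 𝔭 = 0 :=
  isVectorGroup_iff_exponent_eq_zero k p 𝔭 (Hironaka1970_thm1_cor_holds p) (hirForms_eq_invForms 𝔭) hP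

/-- **MIZUTANI'S LOWER BOUND `m(e) ≥ 2p^e − 1` IN HIS OWN VOCABULARY, UNCONDITIONALLY**: for every field `k` of
characteristic `p`, every `n` and every point `𝔭` of `ℙ^n_k`, Hironaka's scheme `B_{P,𝔭} = Spec S/U_+(𝔭)S` satisfies
`2·p^{exponent B(𝔭)} ≤ dim B_{P,𝔭} + 1`.  (Mizutani 1973 Remark 2.10 asked whether `m(e) = 2p^e − 1`; `≥` is the tree's
`mizutaniLowerBound`, here transported through `hirForms_eq_invForms` (G1) and `Hironaka1970_thm1_cor_holds` (G2).)
[cite: Mizutani1973HironakaGroupSchemes, Remark 2.10 ("it is quite likely that m(e) = 2p^e − 1")] -/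
theorem mizutani_lowerBound_hironaka [𝔭.IsPrime] (hP : IsPoint k 𝔭) :
    (2 * p ^ exponent k p 𝔭 : WithBot ℕ∞) ≤ ringKrullDim (MvPolynomial (Fin (n + 1)) k ⧸ bIdeal k 𝔭) + 1 :=
  two_mul_pow_exponent_le_ringKrullDim_bIdeal_succ' k p 𝔭 (Hironaka1970_thm1_cor_holds p) hP

/-- The same for every `e ≤ exponent B(𝔭)`: `2·p^e ≤ dim B_{P,𝔭} + 1` — every point "whose exponent is not less than `e`"
(Mizutani's definition of `m(e)`) has `dim B_{P,𝔭} ≥ 2p^e − 1`. [cite: Mizutani1973HironakaGroupSchemes, Remark 2.10] -/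
theorem mizutani_lowerBound_hironaka' [𝔭.IsPrime] (hP : IsPoint k 𝔭) {e : ℕ} (he : e ≤ exponent k p 𝔭) :
    (2 * p ^ e : WithBot ℕ∞) ≤ ringKrullDim (MvPolynomial (Fin (n + 1)) k ⧸ bIdeal k 𝔭) + 1 := by
  refine le_trans ?_ (mizutani_lowerBound_hironaka k p 𝔭 hP)
  have h : 2 * p ^ e ≤ 2 * p ^ exponent k p 𝔭 :=
    Nat.mul_le_mul_left 2 (Nat.pow_le_pow_right hp.out.pos he)
  exact_mod_cast h

end HironakaSide

section Attained

variable {k : Type u} [Field k] {p e : ℕ} [hp : Fact p.Prime] [CharP k p] {u : Fin 2 → k}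

/-- **MIZUTANI'S `H_e` IN HIS OWN VOCABULARY, UNCONDITIONALLY** (`m(e) ≤ 2p^e − 1`): over every field `k` of
characteristic `p` with a `p`-independent pair `u` and for every `e ≥ 1`, the point `attP k p e u` of `ℙ^{2p^e − 2}_k`
(encloser-2's `GenAtt.attP`, Mizutani's Remark 2.10 / Oda's Example 2.1 for `e = 1`) has Hironaka scheme of exponent `e`
and `dim B_{P,𝔭} + 1 = 2p^e`. [cite: Mizutani1973HironakaGroupSchemes, Remark 2.10 (the schemes H_e: e(H_e) = e, dim H_e = 2p^e − 1)] -/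
theorem mizutani_attained_hironaka (hu : PIndep p 1 u) (he : 1 ≤ e) :
    exponent k p (GenAtt.attP k p e u) = e ∧
      ringKrullDim (MvPolynomial (Fin (attN p e + 1)) k ⧸ bIdeal k (GenAtt.attP k p e u)) + 1 = (2 * p ^ e : WithBot ℕ∞) := by
  have hP : IsPoint k (GenAtt.attP k p e u) := GenAtt.isPoint_attP fun l => GenAtt.ne_zero_of_pIndep hu l
  haveI : (GenAtt.attP k p e u).IsPrime := hP.1
  refine ⟨GenAtt.exponent_attP hu he, ?_⟩
  rw [ringKrullDim_quotient_bIdeal_eq_hsDim_holds k p _ hP,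
    ← hsDimAt_eq_hsDim k p (GenAtt.attP k p e u) (GenAtt.exponentLE_attP hu he)]
  have h := GenAtt.hsDimAt_attP hu he
  exact_mod_cast h

/-- The attainment for every field with `[k : k^p] > p` (a `p`-independent pair exists, `GenAtt.exists_pIndep_two_of_lt_rank`).
[cite: Mizutani1973HironakaGroupSchemes, Remark 2.10 ("let k be a field such that [k : k^p] ≥ p^2")] -/
theorem mizutani_attained_hironaka_of_lt_rank (k : Type u) [Field k] (p : ℕ) [Fact p.Prime] [CharP k p]
    (hk : (p : Cardinal.{u}) < Module.rank (frobPow k p 1) k) {e : ℕ} (he : 1 ≤ e) :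
    ∃ 𝔭 : Ideal (MvPolynomial (Fin (attN p e + 1)) k), ∃ _ : 𝔭.IsPrime, IsPoint k 𝔭 ∧ exponent k p 𝔭 = e ∧
      ringKrullDim (MvPolynomial (Fin (attN p e + 1)) k ⧸ bIdeal k 𝔭) + 1 = (2 * p ^ e : WithBot ℕ∞) := by
  obtain ⟨u, hu⟩ := exists_pIndep_two_of_lt_rank k p hk
  have hP : IsPoint k (GenAtt.attP k p e u) := GenAtt.isPoint_attP fun l => GenAtt.ne_zero_of_pIndep hu l
  exact ⟨GenAtt.attP k p e u, hP.1, hP, mizutani_attained_hironaka hu he⟩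

end Attained

end Summit.ResolutionOfSingularities.KangarooAtlas.Mizutani
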